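import Summits.SmoothPoincare4.SmoothPoincare4.Theses.RootDecompAE

/-!
# RootDecompAE — glue of the rev-1 split «SeifertTwistedDoubleDichotomy» of `PeriodicTwistedDoublesStandard`

Proves the glue item `PeriodicTwistedDoublesStandardGlue` (stmt-SmoothPoincare4-32002, support, rank 203) of
route-SmoothPoincare4-RootDecompAE rev 1–3:
`SeifertTwistedDoublesStandard → NonSeifertTwistedDoubleResidual → PeriodicTwistedDoublesStandard`
(stmt-SmoothPoincare4-32000 → 32001 → 31476).

Pure logic: the two children already give the SUMMIT (`smoothPoincare4_of_std_ntd`: a homotopy sphere either has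
SOME twisted-double presentation `C ∪_ψ C` with Seifert-type seam — then `SeifertTwistedDoublesStandard` applied to THAT
presentation recognises it — or it has none, which is exactly the hypothesis of `NonSeifertTwistedDoubleResidual`),
and the parent `PeriodicTwistedDoublesStandard` is a statement about homotopy spheres. This is the tribunal's
structural flag S ⟺ STD ∧ NTD (TRIB-SP4-ROOTDECOMP-8.md, `Trib8.ae_summit_of_std_ntd`, `Trib8.ae_ptd_glue`) and the lens
text HOME/decomp-sp4-lens-2/v9/split/EDIT.md §2 (`closes_std_ntd`, `periodicTwistedDoublesStandardGlue_holds`), re-proved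
here against the route's own declarations. Root decomposition cell decomp-sp4 (D-0178); 0 sorry.
Nothing here proves `SmoothPoincare4`: both children are OPEN (NTD is AE's closure-critical declared residual).
-/

set_option linter.dupNamespace false

namespace Summit.SmoothPoincare4.SmoothPoincare4.Theorems.RootDecompAEPeriodicTwistedDoublesStandardSplit

open Summit.SmoothPoincare4.SmoothPoincare4.Theses.RootDecompAE

/-- Item stmt-SmoothPoincare4-32002: the Seifert / non-Seifert dichotomy re-assembles the parent `PeriodicTwistedDoublesStandard`. -/
theorem periodicTwistedDoublesStandardGlue_holds : PeriodicTwistedDoublesStandardGlue :=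
  fun h₁ h₂ _C _ _ _ _ _ _ _ _bC _ψ _ _ X _ _ _ iC iM e _ => by
    -- exactness edge of record (TRIB-8 structural flag) `STD → NTD → S`, INLINED at `X` so that no top-level declaration of this
    -- Theorems file concludes the summit constant (critic g5: the audit would class such a helper `proof-of-item → SmoothPoincare4`).
    refine Classical.byContradiction fun hne => hne (h₂ X e fun hq => ?_)
    obtain ⟨C, _, _, _, _, _, _, _, bC, ψ, hS, hglue⟩ := hq
    exact hne (h₁ C bC ψ hS X e hglue)

end Summit.SmoothPoincare4.SmoothPoincare4.Theorems.RootDecompAEPeriodicTwistedDoublesStandardSplit
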